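import Mathlib
import HarnessLib
import Literature.NumberTheory.DiophantineGeometry.ConicParametrisationCount
import Literature.NumberTheory.QuadraticForms.HasseMinkowskiTernaryRat

/-!
# A primitive integral point on `aX² + bY² = cZ²` from the local conditions (Legendre)

For square-free `abc` with `a, b, c ≥ 1`, the conic `aX² + bY² = cZ²` has a rational point as
soon as `bc` is a square mod every odd `p ∣ a`, `ca` mod every odd `p ∣ b` and `−ab` mod every
odd `p ∣ c` (Legendre; the condition at `2` is implied by the product formula). We obtain it
from the tree's Hasse–Minkowski theorem for ternary forms over `ℚ`
(`Literature.NumberTheory.QuadraticForms.hilbertSymbol_rat_eq_one_of_odd_places`: the form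
`Z² − (ac)X² − (bc)Y²`) by computing the explicit local symbols `(ac, bc)_p = localSignOdd p …`
at the odd primes, and then clear denominators and take the primitive part:
`exists_primitive_zero` gives `P ∈ ℤ³` with `aP₀² + bP₁² = cP₂²`, `gcd(P) = 1`, `P₂ > 0`.
This is the base point of the parametrisation used for Browning–Van Valckenborgh 2012, Thm. 1.

## References

* J.-P. Serre, *A Course in Arithmetic*, Ch. IV §3.2 Thm. 8 (ii) (through the tree).
* T. D. Browning, K. Van Valckenborgh, *Sums of three squareful numbers*, Exp. Math. 21 (2012),
  §3. [cite: BrowningValckenborgh2012, §3]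
-/

noncomputable section

open IsDedekindDomain NumberField Rat.HeightOneSpectrum

namespace Literature.NumberTheory.DiophantineGeometry

open Literature.NumberTheory.QuadraticForms

/-! ### The local symbols `(ac, bc)_p` -/

/-- **The odd local symbols of `(ac, bc)`** are `1` under Legendre's conditions. [folklore] -/
theorem localSignOdd_ac_bc_eq_one {a b c : ℕ} (hd : Squarefree (a * b * c)) {p : ℕ}
    [hp : Fact p.Prime] (hp2 : p ≠ 2)
    (hqa : p ∣ a → legendreSym p ((b : ℤ) * c) = 1) (hqb : p ∣ b → legendreSym p ((a : ℤ) * c) = 1)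
    (hqc : p ∣ c → legendreSym p (-((a : ℤ) * b)) = 1) :
    localSignOdd p ((a : ℤ) * c) ((b : ℤ) * c) = 1 := by
  have habc : a * b * c ≠ 0 := hd.ne_zero
  have ha0 : (a : ℤ) ≠ 0 := by exact_mod_cast (by rintro rfl; simp at habc : a ≠ 0)
  have hb0 : (b : ℤ) ≠ 0 := by exact_mod_cast (by rintro rfl; simp at habc : b ≠ 0)
  have hc0 : (c : ℤ) ≠ 0 := by exact_mod_cast (by rintro rfl; simp at habc : c ≠ 0)
  have hpr : Prime (p : ℤ) := Nat.prime_iff_prime_int.1 hp.out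
  have hp0 : (p : ℤ) ≠ 0 := by exact_mod_cast hp.out.ne_zero
  -- expand by multiplicativity: `(ac, bc) = (a,b)(a,c)(c,b)(c,c)`
  have hright : ∀ x : ℤ, x ≠ 0 → localSignOdd p x ((b : ℤ) * c) = localSignOdd p x b * localSignOdd p x c := by
    intro x _
    rw [localSignOdd_comm, localSignOdd_mul_left hb0 hc0, localSignOdd_comm (b : ℤ), localSignOdd_comm (c : ℤ)]
  have expand : localSignOdd p ((a : ℤ) * c) ((b : ℤ) * c) =
      localSignOdd p a b * localSignOdd p a c * (localSignOdd p c b * localSignOdd p c c) := by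
    rw [localSignOdd_mul_left ha0 hc0, hright _ ha0, hright _ hc0]
  rw [expand]
  -- the square-free structure: at most one of `a, b, c` is divisible by `p`, exactly once
  have hsq : ∀ x y : ℕ, Squarefree (x * y) → p ∣ x → ¬p ∣ y := by
    intro x y hxy hx hy
    have : p * p ∣ x * y := mul_dvd_mul hx hy
    exact hp.out.ne_one (by simpa using hxy p this)
  have hab : Squarefree (a * b) := Squarefree.of_mul_left hd
  have hac : Squarefree (a * c) := hd.squarefree_of_dvd ⟨b, by ring⟩
  have hbc : Squarefree (b * c) := Squarefree.of_mul_right (by rwa [mul_assoc] at hd)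
  -- `x = p x₁` with `p ∤ x₁` for a square-free `x` divisible by `p`
  have hdecomp : ∀ x : ℕ, Squarefree x → p ∣ x → (x : ℤ) ≠ 0 →
      ∃ x₁ : ℤ, (x : ℤ) = p * x₁ ∧ ¬(p : ℤ) ∣ x₁ ∧ x₁ ≠ 0 := by
    intro x hx hpx hx0
    obtain ⟨x₁, hx₁⟩ := hpx
    refine ⟨x₁, by rw [hx₁]; push_cast; ring, fun h => ?_, ?_⟩
    · have : p * p ∣ x := by rw [hx₁]; exact mul_dvd_mul_left p (Int.natCast_dvd_natCast.1 h)
      exact hp.out.ne_one (by simpa using hx p this)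
    · intro h0
      apply hx0; rw [hx₁]; push_cast; rw [h0, mul_zero]
  have nd : ∀ {x : ℕ}, ¬p ∣ x → ¬(p : ℤ) ∣ (x : ℤ) := fun h h' => h (Int.natCast_dvd_natCast.1 h')
  -- `(p x₁, w)_p = (w / p)` and `(p x₁, p x₁)_p = χ₄(p)` for `p ∤ x₁ w`
  have key : ∀ (x₁ w : ℤ), x₁ ≠ 0 → ¬(p : ℤ) ∣ x₁ → ¬(p : ℤ) ∣ w →
      localSignOdd p (p * x₁) w = legendreSym p w := by
    intro x₁ w hx₁ hx₁' hw
    rw [localSignOdd_mul_left hp0 hx₁, localSignOdd_of_not_dvd hx₁' hw, mul_one, localSignOdd_comm,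
      localSignOdd_self_right hw]
  have key2 : ∀ x₁ : ℤ, x₁ ≠ 0 → ¬(p : ℤ) ∣ x₁ →
      localSignOdd p (p * x₁) (p * x₁) = ZMod.χ₄ (p : ZMod 4) := by
    intro x₁ hx₁ hx₁'
    rw [localSignOdd_mul_left hp0 hx₁, localSignOdd_comm (p : ℤ) ((p : ℤ) * x₁),
      localSignOdd_comm x₁ ((p : ℤ) * x₁), localSignOdd_mul_left hp0 hx₁, localSignOdd_mul_left hp0 hx₁,
      localSignOdd_self_self, localSignOdd_of_not_dvd hx₁' hx₁', localSignOdd_comm (p : ℤ) x₁,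
      localSignOdd_self_right hx₁']
    have hsq1 : legendreSym p x₁ * legendreSym p x₁ = 1 := by
      rw [← pow_two]
      exact legendreSym.sq_one (p := p) (fun h0 => hx₁' ((ZMod.intCast_zmod_eq_zero_iff_dvd x₁ p).1 h0))
    linear_combination (ZMod.χ₄ (p : ZMod 4)) * hsq1
  by_cases hpa : p ∣ a
  · have hpb : ¬p ∣ b := hsq a b hab hpa
    have hpc : ¬p ∣ c := hsq a c hac hpa
    obtain ⟨a₁, ha₁, ha₁', ha₁0⟩ := hdecomp a (Squarefree.of_mul_left hab) hpa ha0
    have hb' := nd hpb; have hc' := nd hpc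
    rw [localSignOdd_of_not_dvd hc' hb', localSignOdd_of_not_dvd hc' hc', ha₁, key a₁ _ ha₁0 ha₁' hb',
      key a₁ _ ha₁0 ha₁' hc']
    have := hqa hpa
    rw [legendreSym.mul] at this
    linear_combination this
  by_cases hpb : p ∣ b
  · have hpc : ¬p ∣ c := hsq b c hbc hpb
    obtain ⟨b₁, hb₁, hb₁', hb₁0⟩ := hdecomp b (Squarefree.of_mul_right hab) hpb hb0
    have ha' := nd hpa; have hc' := nd hpc
    rw [localSignOdd_of_not_dvd ha' hc', localSignOdd_of_not_dvd hc' hc', localSignOdd_comm (a : ℤ),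
      localSignOdd_comm (c : ℤ), hb₁, key b₁ _ hb₁0 hb₁' ha', key b₁ _ hb₁0 hb₁' hc']
    have := hqb hpb
    rw [legendreSym.mul] at this
    linear_combination this
  by_cases hpc : p ∣ c
  · obtain ⟨c₁, hc₁, hc₁', hc₁0⟩ := hdecomp c (Squarefree.of_mul_right hac) hpc hc0
    have ha' := nd hpa; have hb' := nd hpb
    rw [localSignOdd_of_not_dvd ha' hb', localSignOdd_comm (a : ℤ), hc₁, key c₁ _ hc₁0 hc₁' ha',
      key c₁ _ hc₁0 hc₁' hb', key2 c₁ hc₁0 hc₁', ← legendreSym.at_neg_one hp2]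
    have := hqc hpc
    rw [show -((a : ℤ) * b) = (-1) * (a * b) by ring, legendreSym.mul, legendreSym.mul] at this
    linear_combination this
  · have ha' := nd hpa; have hb' := nd hpb; have hc' := nd hpc
    rw [localSignOdd_of_not_dvd ha' hb', localSignOdd_of_not_dvd ha' hc', localSignOdd_of_not_dvd hc' hb',
      localSignOdd_of_not_dvd hc' hc']
    ring

end Literature.NumberTheory.DiophantineGeometry

namespace Literature.NumberTheory.DiophantineGeometry

open Literature.NumberTheory.QuadraticForms

/-! ### The rational point and the primitive integral base point -/

/-- **Legendre's theorem for `aX² + bY² = cZ²`** (from the tree's ternary Hasse–Minkowski over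
`ℚ`): for square-free `abc` with Legendre's conditions at the odd primes there is a rational
solution with `Z ≠ 0`. [folklore] -/
theorem exists_rat_zero {a b c : ℕ} (hd : Squarefree (a * b * c))
    (hqa : ∀ p : ℕ, p.Prime → p ∣ a → p ≠ 2 → ∃ _ : Fact p.Prime, legendreSym p ((b : ℤ) * c) = 1)
    (hqb : ∀ p : ℕ, p.Prime → p ∣ b → p ≠ 2 → ∃ _ : Fact p.Prime, legendreSym p ((a : ℤ) * c) = 1)
    (hqc : ∀ p : ℕ, p.Prime → p ∣ c → p ≠ 2 → ∃ _ : Fact p.Prime, legendreSym p (-((a : ℤ) * b)) = 1) :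
    ∃ x y z : ℚ, z ≠ 0 ∧ (a : ℚ) * x ^ 2 + (b : ℚ) * y ^ 2 = (c : ℚ) * z ^ 2 := by
  have habc : a * b * c ≠ 0 := hd.ne_zero
  have ha0 : (a : ℤ) ≠ 0 := by exact_mod_cast (by rintro rfl; simp at habc : a ≠ 0)
  have hb0 : (b : ℤ) ≠ 0 := by exact_mod_cast (by rintro rfl; simp at habc : b ≠ 0)
  have hc0 : (c : ℤ) ≠ 0 := by exact_mod_cast (by rintro rfl; simp at habc : c ≠ 0)
  have hac0 : ((a : ℤ) * c : ℚ) ≠ 0 := by exact_mod_cast mul_ne_zero ha0 hc0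
  have hbc0 : ((b : ℤ) * c : ℚ) ≠ 0 := by exact_mod_cast mul_ne_zero hb0 hc0
  -- the Hilbert symbol `(ac, bc)_ℚ = 1`
  have hH : hilbertSymbol ℚ (((a : ℤ) * c : ℤ) : ℚ) (((b : ℤ) * c : ℤ) : ℚ) = 1 := by
    refine hilbertSymbol_rat_eq_one_of_odd_places (by exact_mod_cast mul_ne_zero ha0 hc0)
      (by exact_mod_cast mul_ne_zero hb0 hc0) (fun v hv => ?_) (Or.inl (by positivity))
    rw [hilbertSymbol_rat_eq_localSignOdd v hv (mul_ne_zero ha0 hc0) (mul_ne_zero hb0 hc0)]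
    haveI : Fact (natGenerator v).Prime := ⟨prime_natGenerator v⟩
    refine localSignOdd_ac_bc_eq_one hd hv (fun h => ?_) (fun h => ?_) (fun h => ?_)
    · obtain ⟨_, e⟩ := hqa _ (prime_natGenerator v) h hv; convert e
    · obtain ⟨_, e⟩ := hqb _ (prime_natGenerator v) h hv; convert e
    · obtain ⟨_, e⟩ := hqc _ (prime_natGenerator v) h hv; convert e
  obtain ⟨x, y, z, hz, h⟩ := exists_ternary_zero_of_hilbertSymbol_eq_one hH
  -- `z² = ac x² + bc y²`, so `a x² + b y² = c (z/c)²`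
  refine ⟨x, y, z / c, div_ne_zero hz (by exact_mod_cast hc0), ?_⟩
  have hcq : (c : ℚ) ≠ 0 := by exact_mod_cast hc0
  push_cast at h
  have e : (c : ℚ) * (z / c) ^ 2 = z ^ 2 / c := by
    field_simp
  rw [e, eq_div_iff hcq]
  linear_combination -h

/-- **A primitive integral base point**: under the same conditions there is `P ∈ ℤ³` with
`aP₀² + bP₁² = cP₂²` (`ternForm (a, b, −c) P = 0`), `gcd(P) = 1` and `P₂ > 0`. [folklore] -/
theorem exists_primitive_zero {a b c : ℕ} (hd : Squarefree (a * b * c))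
    (hqa : ∀ p : ℕ, p.Prime → p ∣ a → p ≠ 2 → ∃ _ : Fact p.Prime, legendreSym p ((b : ℤ) * c) = 1)
    (hqb : ∀ p : ℕ, p.Prime → p ∣ b → p ≠ 2 → ∃ _ : Fact p.Prime, legendreSym p ((a : ℤ) * c) = 1)
    (hqc : ∀ p : ℕ, p.Prime → p ∣ c → p ≠ 2 → ∃ _ : Fact p.Prime, legendreSym p (-((a : ℤ) * b)) = 1) :
    ∃ P : ℤ × ℤ × ℤ, ternForm ((a : ℤ), (b : ℤ), -(c : ℤ)) P = 0 ∧ content3 P = 1 ∧ 0 < P.2.2 := by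
  obtain ⟨x, y, z, hz, h⟩ := exists_rat_zero hd hqa hqb hqc
  -- clear denominators: `N = d_x d_y d_z`
  set X : ℤ := x.num * y.den * z.den with hX
  set Y : ℤ := y.num * x.den * z.den with hY
  set Z : ℤ := z.num * x.den * y.den with hZ
  have hxq : (X : ℚ) = x * (x.den * y.den * z.den : ℚ) := by
    rw [hX]; push_cast; rw [← Rat.mul_den_eq_num x]; ring
  have hyq : (Y : ℚ) = y * (x.den * y.den * z.den : ℚ) := by
    rw [hY]; push_cast; rw [← Rat.mul_den_eq_num y]; ring
  have hzq : (Z : ℚ) = z * (x.den * y.den * z.den : ℚ) := by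
    rw [hZ]; push_cast; rw [← Rat.mul_den_eq_num z]; ring
  have hZ0 : Z ≠ 0 := by
    rw [hZ]; exact mul_ne_zero (mul_ne_zero (Rat.num_ne_zero.2 hz) (by exact_mod_cast x.den_nz))
      (by exact_mod_cast y.den_nz)
  set Q : ℤ × ℤ × ℤ := (X, Y, Z) with hQ
  have hQF : ternForm ((a : ℤ), (b : ℤ), -(c : ℤ)) Q = 0 := by
    have hN : ((x.den * y.den * z.den : ℕ) : ℚ) ≠ 0 := by
      exact_mod_cast mul_ne_zero (mul_ne_zero x.den_nz y.den_nz) z.den_nz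
    have key : ((ternForm ((a : ℤ), (b : ℤ), -(c : ℤ)) Q : ℤ) : ℚ) = 0 := by
      simp only [ternForm, hQ]
      push_cast
      rw [hxq, hyq, hzq]
      linear_combination ((x.den : ℚ) * y.den * z.den) ^ 2 * h
    exact_mod_cast key
  have hQ0 : Q ≠ 0 := fun h0 => hZ0 (by have := congr_arg (fun w => w.2.2) h0; simpa [hQ] using this)
  -- primitive part, with positive last coordinate
  set R := primPart Q with hR
  have hRc : content3 R = 1 := content3_primPart hQ0
  have hRF : ternForm ((a : ℤ), (b : ℤ), -(c : ℤ)) R = 0 := ternForm_primPart_eq_zero hQ0 hQF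
  have hR2 : R.2.2 ≠ 0 := by
    intro h0
    have e := content3_smul_primPart Q
    rw [← hR] at e
    have e2 : ((content3 Q : ℤ) • R).2.2 = Q.2.2 := by rw [e]
    simp only [Prod.smul_snd, smul_eq_mul, h0, mul_zero] at e2
    exact hZ0 (by rw [hQ] at e2; exact e2.symm)
  rcases lt_or_gt_of_ne hR2 with hneg | hpos
  · refine ⟨-R, ?_, by rw [content3_neg]; exact hRc, by simpa using hneg⟩
    have := ternForm_zsmul ((a : ℤ), (b : ℤ), -(c : ℤ)) (-1) R
    simp only [neg_smul, one_smul] at this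
    rw [this, hRF, mul_zero]
  · exact ⟨R, hRF, hRc, hpos⟩

end Literature.NumberTheory.DiophantineGeometry
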